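import Summits.ValiantsHypothesis.ValiantsHypothesis.Theorems.TwoProducts.RankThreeWronskianRule

/-!
# Rank-three WRONSKIAN TRANSFER (the load-bearing step of rung 3-LIN) and the dependent case — in the kernel

`IsUniqueTop`, `lam`, `IsLineSpecial`, `def WronskianTransfer : Prop` (proved in-file), `coeff_jac_uniqueTop`, `wt_le_of_mem_support_ell`, ★ `coeff_ell_top`, `onLine_unique`,
★★ `wronskianTransfer : WronskianTransfer`, ★ `dependentCase3`.

PORT (val-lit-p3 g18) under val-idea-crit-8 g4's VERDICT #44 LICENCE (R3a/R3b; «import landed `Theorems/TwoProducts/RankTwoJacobian.lean` vocabulary — never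
re-declare `Poly2/emb/nv/theta/jac/wt/IsEdgeDir/idet/jacDer/derivation_map_aeval`») of val-idea-35 g10's crux workfile
`Cruxes/TwoProducts/RankThreeWronskian_val_idea_35_g10.lean` (tree bytes, rung 3-LIN of the SIDE ladder «table-rank-ladder»; VERDICT #44 ACCEPTED: kernel ★ rule +
top coefficient + transfer + dependent case) — bodies VERBATIM, namespace `…Cruxes.TwoProducts.ValIdea35g10` → `…Theorems.TwoProducts.RankTwoJacobian` (the landed
rank-two vocabulary is reused BY NAME; `jac_self`, `jacDer_apply`, `theta_*`, `support_jac_subset`, `wt_add`, `coeff_mul_of_unique`, `idet_zero_right`, `jac_eq_sum`,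
`coeff_jac` are the ✓ `…RankTwoJacobian{,Ostrowski,Axial}` theorems, not restated).  NOT ported (fact debt per the licence): `RankThreeLinearLaw` /
`RankThreeExplicitBound` / `TwoProductsLinRankThree` / `PortPlan3` and their bridges — they wait for `PortPlan3.1` in the kernel (idea-35 g10's `TowerKernel3`).
HONEST LABEL: helper lemmas of rung 3-LIN; the rank-three law is PAPER (count) until `PortPlan3.1` lands; 0 distance on `ResidualLawV25`; 5906 / PCB OPEN;
VP ≠ VNP is NOT proved.  `--supports stmt-ValiantsHypothesis-5906 --as helper`.  Credit: val-idea-35 g10.  No instances, no notation, no named facts. [folklore]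
-/

noncomputable section
set_option linter.dupNamespace false

namespace Summit.ValiantsHypothesis.ValiantsHypothesis.Theorems.TwoProducts.RankTwoJacobian

open scoped BigOperators Pointwise
open MvPolynomial

/-- `p` is the STRICT `ν`-top exponent of `w` (on an arc of directions avoiding the `≤ 9t²` crossing directions of
`S₀ ∪ S₁ ∪ S₂`, every `wᵢ'` of the `ν`-echelon basis has one, and the three pivots have distinct weights). -/
def IsUniqueTop (ν : Fin 2 → ℝ) (w : Poly2) (p : Fin 2 →₀ ℕ) : Prop :=
  p ∈ w.support ∧ ∀ s ∈ w.support, s ≠ p → wt ν s < wt ν p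

/-- The multiplier of the transfer: `λ_k(γ) = det(γ,p₀) − det(γ,p₁) + k·det(p₀,p₁) = det(γ − k·p₀, p₀ − p₁)`;
it vanishes exactly on the LINE through `k·p₀` and `k·p₁`. -/
def lam (k : ℕ) (p₀ p₁ γ : Fin 2 →₀ ℕ) : ℤ := idet γ p₀ - idet γ p₁ + (k : ℤ) * idet p₀ p₁

/-- `ν` is LINE-SPECIAL for `F` (w.r.t. `k, p₀, p₁`): the `ν`-top set of `supp F` is exactly two points, one ON the line
`λ_k = 0`.  Such a point is a vertex of `Newt F` on a fixed line, so there are `≤ 2·2 = 4` line-special directions per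
(arc, `F`) — the only directions the transfer can lose. -/
def IsLineSpecial (ν : Fin 2 → ℝ) (F : Poly2) (k : ℕ) (p₀ p₁ : Fin 2 →₀ ℕ) : Prop :=
  ∃ p ∈ F.support, ∃ q ∈ F.support, p ≠ q ∧ (∀ r ∈ F.support, wt ν r ≤ wt ν p) ∧ wt ν q = wt ν p ∧
    (∀ r ∈ F.support, wt ν r = wt ν p → r = p ∨ r = q) ∧ (lam k p₀ p₁ p = 0 ∨ lam k p₀ p₁ q = 0)

/-- WRONSKIAN TRANSFER (typed; PROVED below as `wronskianTransfer`). -/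
def WronskianTransfer : Prop :=
  ∀ (ν : Fin 2 → ℝ) (F u v : Poly2) (k : ℕ) (p₀ p₁ : Fin 2 →₀ ℕ),
    F ≠ 0 → IsUniqueTop ν u p₀ → IsUniqueTop ν v p₁ → wt ν p₀ ≠ wt ν p₁ → IsEdgeDir ν F →
    IsLineSpecial ν F k p₀ p₁ ∨ IsEdgeDir ν (ell k u v F)

/-- A unique top dominates the support. [folklore] -/
theorem IsUniqueTop.le {ν : Fin 2 → ℝ} {w : Poly2} {p : Fin 2 →₀ ℕ} (h : IsUniqueTop ν w p) :
    ∀ s ∈ w.support, wt ν s ≤ wt ν p := by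
  intro s hs
  by_cases hsp : s = p
  · rw [hsp]
  · exact le_of_lt (h.2 s hs hsp)

/-- A support point as heavy as the unique top is the unique top. [folklore] -/
theorem IsUniqueTop.eq_of_le {ν : Fin 2 → ℝ} {w : Poly2} {p : Fin 2 →₀ ℕ} (h : IsUniqueTop ν w p)
    {s : Fin 2 →₀ ℕ} (hs : s ∈ w.support) (hle : wt ν p ≤ wt ν s) : s = p := by
  by_contra hsp
  exact absurd (h.2 s hs hsp) (not_lt.mpr hle)

/-- weights on `supp J(A,B)` are bounded by top weight of `A` plus top weight of `B` -/
theorem wt_le_of_mem_support_jac (ν : Fin 2 → ℝ) (A B : Poly2) (a b : ℝ)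
    (hA : ∀ x ∈ A.support, wt ν x ≤ a) (hB : ∀ y ∈ B.support, wt ν y ≤ b) :
    ∀ z ∈ (jac A B).support, wt ν z ≤ a + b := by
  intro z hz
  obtain ⟨x, hx, y, hy, rfl⟩ := Finset.mem_add.mp (support_jac_subset A B hz)
  rw [wt_add]; linarith [hA x hx, hB y hy]

/-- Weights of `supp (A·B)` are bounded by the bounds for `A` and `B`. [folklore] -/
theorem wt_le_of_mem_support_mul (ν : Fin 2 → ℝ) (A B : Poly2) (a b : ℝ)
    (hA : ∀ x ∈ A.support, wt ν x ≤ a) (hB : ∀ y ∈ B.support, wt ν y ≤ b) :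
    ∀ z ∈ (A * B).support, wt ν z ≤ a + b := by
  intro z hz
  obtain ⟨x, hx, y, hy, rfl⟩ := Finset.mem_add.mp (MvPolynomial.support_mul A B hz)
  rw [wt_add]; linarith [hA x hx, hB y hy]

/-- The TOP coefficient of `J(F,w)` above a top point `γ₀` of `F`, when `p` is the unique top of `w`. -/
theorem coeff_jac_uniqueTop (ν : Fin 2 → ℝ) (F w : Poly2) (p γ₀ : Fin 2 →₀ ℕ) (hw : IsUniqueTop ν w p)
    (hγ₀ : γ₀ ∈ F.support) (htop : ∀ r ∈ F.support, wt ν r ≤ wt ν γ₀) :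
    coeff (γ₀ + p) (jac F w) = coeff γ₀ F * coeff p w * ((idet γ₀ p : ℤ) : ℂ) := by
  have hp := hw.1
  rw [coeff_jac]
  rw [Finset.sum_eq_single (γ₀, p)]
  · simp
  · rintro ⟨γ, s⟩ hx hne
    obtain ⟨hγ, hs⟩ := Finset.mem_product.mp hx
    dsimp only
    split_ifs with h
    · exfalso
      by_cases hse : s = p
      · subst hse
        exact hne (Prod.ext (add_right_cancel h) rfl)
      · have hlt := hw.2 s hs hse
        have hle := htop γ hγ
        have hw' : wt ν γ + wt ν s = wt ν γ₀ + wt ν p := by rw [← wt_add, ← wt_add, h]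
        linarith
    · rfl
  · intro hn
    exact absurd (Finset.mem_product.mpr ⟨hγ₀, hp⟩) hn

/-- All weights on `supp (L_k^{u,v} F)` are `≤ wt γ₀ + wt p₀ + wt p₁` (`γ₀` a top point of `F`). -/
theorem wt_le_of_mem_support_ell (ν : Fin 2 → ℝ) (F u v : Poly2) (k : ℕ) (p₀ p₁ γ₀ : Fin 2 →₀ ℕ)
    (hu : IsUniqueTop ν u p₀) (hv : IsUniqueTop ν v p₁) (htop : ∀ r ∈ F.support, wt ν r ≤ wt ν γ₀) :
    ∀ r ∈ (ell k u v F).support, wt ν r ≤ wt ν γ₀ + wt ν p₀ + wt ν p₁ := by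
  intro r hr
  unfold ell at hr
  rcases Finset.mem_union.mp (MvPolynomial.support_add hr) with h12 | h3
  · rcases Finset.mem_union.mp ((MvPolynomial.support_sub ..) h12) with hA | hB
    · have := wt_le_of_mem_support_mul ν v (jac F u) (wt ν p₁) (wt ν γ₀ + wt ν p₀) hv.le
        (wt_le_of_mem_support_jac ν F u (wt ν γ₀) (wt ν p₀) htop hu.le) r hA
      linarith
    · have := wt_le_of_mem_support_mul ν u (jac F v) (wt ν p₀) (wt ν γ₀ + wt ν p₁) hu.le
        (wt_le_of_mem_support_jac ν F v (wt ν γ₀) (wt ν p₁) htop hv.le) r hB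
      linarith
  · have h3' := MvPolynomial.support_smul h3
    have := wt_le_of_mem_support_mul ν (jac u v) F (wt ν p₀ + wt ν p₁) (wt ν γ₀)
      (wt_le_of_mem_support_jac ν u v (wt ν p₀) (wt ν p₁) hu.le hv.le) htop r h3'
    linarith

/-- **TOP COEFFICIENT FORMULA**: above a top point `γ` of `F`, the coefficient of `X^{γ+p₀+p₁}` in `L_k^{u,v} F` is
`F_γ · u_{p₀} · v_{p₁} · λ_k(γ)` — so it vanishes iff `γ` lies on the line `λ_k = 0`. -/
theorem coeff_ell_top (ν : Fin 2 → ℝ) (F u v : Poly2) (k : ℕ) (p₀ p₁ γ : Fin 2 →₀ ℕ)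
    (hu : IsUniqueTop ν u p₀) (hv : IsUniqueTop ν v p₁)
    (hγ : γ ∈ F.support) (htop : ∀ r ∈ F.support, wt ν r ≤ wt ν γ) :
    coeff (γ + p₀ + p₁) (ell k u v F) = coeff γ F * coeff p₀ u * coeff p₁ v * ((lam k p₀ p₁ γ : ℤ) : ℂ) := by
  have hA : coeff (γ + p₀ + p₁) (v * jac F u) = coeff p₁ v * (coeff γ F * coeff p₀ u * ((idet γ p₀ : ℤ) : ℂ)) := by
    rw [show γ + p₀ + p₁ = p₁ + (γ + p₀) from add_comm _ _]
    rw [coeff_mul_of_unique v (jac F u) p₁ (γ + p₀) ?_, coeff_jac_uniqueTop ν F u p₀ γ hu hγ htop]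
    intro a ha b hb hab
    have hwa := hv.le a ha
    have hwb := wt_le_of_mem_support_jac ν F u (wt ν γ) (wt ν p₀) htop hu.le b hb
    have hsum := congrArg (wt ν) hab
    simp only [wt_add] at hsum
    have ha' : a = p₁ := hv.eq_of_le ha (by linarith)
    refine ⟨ha', ?_⟩
    rw [ha'] at hab
    exact add_left_cancel hab
  have hB : coeff (γ + p₀ + p₁) (u * jac F v) = coeff p₀ u * (coeff γ F * coeff p₁ v * ((idet γ p₁ : ℤ) : ℂ)) := by
    rw [show γ + p₀ + p₁ = p₀ + (γ + p₁) by rw [add_right_comm, add_comm]]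
    rw [coeff_mul_of_unique u (jac F v) p₀ (γ + p₁) ?_, coeff_jac_uniqueTop ν F v p₁ γ hv hγ htop]
    intro a ha b hb hab
    have hwa := hu.le a ha
    have hwb := wt_le_of_mem_support_jac ν F v (wt ν γ) (wt ν p₁) htop hv.le b hb
    have hsum := congrArg (wt ν) hab
    simp only [wt_add] at hsum
    have ha' : a = p₀ := hu.eq_of_le ha (by linarith)
    refine ⟨ha', ?_⟩
    rw [ha'] at hab
    exact add_left_cancel hab
  have hC : coeff (γ + p₀ + p₁) (jac u v * F) = coeff p₀ u * coeff p₁ v * ((idet p₀ p₁ : ℤ) : ℂ) * coeff γ F := by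
    rw [show γ + p₀ + p₁ = (p₀ + p₁) + γ by rw [add_assoc, add_comm]]
    rw [coeff_mul_of_unique (jac u v) F (p₀ + p₁) γ ?_, coeff_jac_uniqueTop ν u v p₁ p₀ hv hu.1 hu.le]
    intro a ha b hb hab
    obtain ⟨x, hx, y, hy, rfl⟩ := Finset.mem_add.mp (support_jac_subset u v ha)
    have hwb := htop b hb
    have hsum := congrArg (wt ν) hab
    simp only [wt_add] at hsum
    have hx' : x = p₀ := hu.eq_of_le hx (by linarith [hu.le x hx, hv.le y hy])
    have hy' : y = p₁ := hv.eq_of_le hy (by linarith [hu.le x hx, hv.le y hy])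
    rw [hx', hy'] at hab ⊢
    exact ⟨rfl, add_left_cancel hab⟩
  unfold ell
  rw [coeff_add, coeff_sub, coeff_smul, hA, hB, hC, smul_eq_mul]
  simp only [lam, Int.cast_add, Int.cast_sub, Int.cast_mul, Int.cast_natCast]
  ring

/-- Two points of equal `ν`-weight on the line `λ_k = 0` coincide, because that line has direction `p₀ − p₁` and
`⟨ν, p₀ − p₁⟩ ≠ 0`. -/
theorem onLine_unique (ν : Fin 2 → ℝ) (k : ℕ) (p₀ p₁ γ₁ γ₂ : Fin 2 →₀ ℕ) (h01 : wt ν p₀ ≠ wt ν p₁)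
    (hw : wt ν γ₁ = wt ν γ₂) (h1 : lam k p₀ p₁ γ₁ = 0) (h2 : lam k p₀ p₁ γ₂ = 0) : γ₁ = γ₂ := by
  have h1r : ((lam k p₀ p₁ γ₁ : ℤ) : ℝ) = 0 := by exact_mod_cast h1
  have h2r : ((lam k p₀ p₁ γ₂ : ℤ) : ℝ) = 0 := by exact_mod_cast h2
  simp only [lam, idet, Int.cast_add, Int.cast_sub, Int.cast_mul, Int.cast_natCast] at h1r h2r
  unfold wt at hw h01
  -- d = γ₁ − γ₂, e = p₀ − p₁ :  det(d,e) = 0, ⟨ν,d⟩ = 0  ⇒  ⟨ν,e⟩·d = 0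
  have L : (((γ₁ 0 : ℕ) : ℝ) - ((γ₂ 0 : ℕ) : ℝ)) * (((p₀ 1 : ℕ) : ℝ) - ((p₁ 1 : ℕ) : ℝ)) -
      (((γ₁ 1 : ℕ) : ℝ) - ((γ₂ 1 : ℕ) : ℝ)) * (((p₀ 0 : ℕ) : ℝ) - ((p₁ 0 : ℕ) : ℝ)) = 0 := by
    linear_combination h1r - h2r
  have H : ν 0 * (((γ₁ 0 : ℕ) : ℝ) - ((γ₂ 0 : ℕ) : ℝ)) + ν 1 * (((γ₁ 1 : ℕ) : ℝ) - ((γ₂ 1 : ℕ) : ℝ)) = 0 := by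
    linear_combination hw
  have W0 : (ν 0 * ((p₀ 0 : ℕ) : ℝ) + ν 1 * ((p₀ 1 : ℕ) : ℝ) - (ν 0 * ((p₁ 0 : ℕ) : ℝ) + ν 1 * ((p₁ 1 : ℕ) : ℝ))) *
      (((γ₁ 0 : ℕ) : ℝ) - ((γ₂ 0 : ℕ) : ℝ)) = 0 := by
    linear_combination (((p₀ 0 : ℕ) : ℝ) - ((p₁ 0 : ℕ) : ℝ)) * H + (ν 1) * L
  have W1 : (ν 0 * ((p₀ 0 : ℕ) : ℝ) + ν 1 * ((p₀ 1 : ℕ) : ℝ) - (ν 0 * ((p₁ 0 : ℕ) : ℝ) + ν 1 * ((p₁ 1 : ℕ) : ℝ))) *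
      (((γ₁ 1 : ℕ) : ℝ) - ((γ₂ 1 : ℕ) : ℝ)) = 0 := by
    linear_combination (((p₀ 1 : ℕ) : ℝ) - ((p₁ 1 : ℕ) : ℝ)) * H - (ν 0) * L
  have hW : ν 0 * ((p₀ 0 : ℕ) : ℝ) + ν 1 * ((p₀ 1 : ℕ) : ℝ) - (ν 0 * ((p₁ 0 : ℕ) : ℝ) + ν 1 * ((p₁ 1 : ℕ) : ℝ)) ≠ 0 :=
    sub_ne_zero.mpr h01
  have e0 : ((γ₁ 0 : ℕ) : ℝ) = ((γ₂ 0 : ℕ) : ℝ) := by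
    have := (mul_eq_zero.mp W0).resolve_left hW
    linarith
  have e1 : ((γ₁ 1 : ℕ) : ℝ) = ((γ₂ 1 : ℕ) : ℝ) := by
    have := (mul_eq_zero.mp W1).resolve_left hW
    linarith
  ext i
  fin_cases i
  · exact_mod_cast e0
  · exact_mod_cast e1

/-- **THE WRONSKIAN TRANSFER in the kernel.** -/
theorem wronskianTransfer : WronskianTransfer := by
  intro ν F u v k p₀ p₁ hF hu hv h01 hedge
  obtain ⟨p, hp, q, hq, hpq, hpmax, hwq⟩ := hedge
  by_cases hax : ∃ γ₁ ∈ F.support, ∃ γ₂ ∈ F.support,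
      γ₁ ≠ γ₂ ∧ wt ν γ₁ = wt ν p ∧ wt ν γ₂ = wt ν p ∧ lam k p₀ p₁ γ₁ ≠ 0 ∧ lam k p₀ p₁ γ₂ ≠ 0
  · -- Case A: two top points OFF the line ⇒ an edge of `L F` in direction ν
    right
    obtain ⟨γ₁, h1, γ₂, h2, hne, hw1, hw2, hl1, hl2⟩ := hax
    have top1 : ∀ r ∈ F.support, wt ν r ≤ wt ν γ₁ := fun r hr => hw1 ▸ hpmax r hr
    have top2 : ∀ r ∈ F.support, wt ν r ≤ wt ν γ₂ := fun r hr => hw2 ▸ hpmax r hr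
    have mem : ∀ γ ∈ F.support, (∀ r ∈ F.support, wt ν r ≤ wt ν γ) → lam k p₀ p₁ γ ≠ 0 →
        γ + p₀ + p₁ ∈ (ell k u v F).support := by
      intro γ hγ htop hl
      rw [MvPolynomial.mem_support_iff, coeff_ell_top ν F u v k p₀ p₁ γ hu hv hγ htop]
      refine mul_ne_zero (mul_ne_zero (mul_ne_zero ?_ ?_) ?_) ?_
      · exact MvPolynomial.mem_support_iff.mp hγ
      · exact MvPolynomial.mem_support_iff.mp hu.1
      · exact MvPolynomial.mem_support_iff.mp hv.1
      · exact_mod_cast hl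
    refine ⟨γ₁ + p₀ + p₁, mem γ₁ h1 top1 hl1, γ₂ + p₀ + p₁, mem γ₂ h2 top2 hl2, ?_, ?_, ?_⟩
    · intro h
      exact hne (add_right_cancel (add_right_cancel h))
    · intro r hr
      have := wt_le_of_mem_support_ell ν F u v k p₀ p₁ γ₁ hu hv top1 r hr
      rw [wt_add, wt_add]
      exact this
    · simp only [wt_add, hw1, hw2]
  · -- Case B: at most one top point off the line ⇒ ν is line-special for F
    left
    push Not at hax
    have uniq : ∀ γ₁ γ₂ : Fin 2 →₀ ℕ, wt ν γ₁ = wt ν p → wt ν γ₂ = wt ν p →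
        lam k p₀ p₁ γ₁ = 0 → lam k p₀ p₁ γ₂ = 0 → γ₁ = γ₂ :=
      fun γ₁ γ₂ hw1 hw2 hl1 hl2 => onLine_unique ν k p₀ p₁ γ₁ γ₂ h01 (hw1.trans hw2.symm) hl1 hl2
    refine ⟨p, hp, q, hq, hpq, hpmax, hwq, ?_, ?_⟩
    · intro r hr hwr
      by_contra hnot
      push Not at hnot
      obtain ⟨hrp, hrq⟩ := hnot
      by_cases hpa : lam k p₀ p₁ p = 0
      · have hqa : lam k p₀ p₁ q ≠ 0 := fun h => hpq (uniq p q rfl hwq hpa h)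
        have hra : lam k p₀ p₁ r ≠ 0 := fun h => hrp (uniq r p hwr rfl h hpa)
        exact hra (hax q hq r hr (fun h => hrq h.symm) hwq hwr hqa)
      · have hqa : lam k p₀ p₁ q = 0 := hax p hp q hq hpq rfl hwq hpa
        have hra : lam k p₀ p₁ r = 0 := hax p hp r hr (fun h => hrp h.symm) rfl hwr hpa
        exact hrq (uniq r q hwr hwq hra hqa)
    · by_contra hno
      push Not at hno
      exact hno.2 (hax p hp q hq hpq rfl hwq hno.1)

/-- **DEPENDENT CASE in the kernel** (`Ω = 0`, i.e. `w₁/w₀, w₂/w₀` algebraically dependent): then NO direction with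
distinct-weight unique tops of `w₀, w₁` is an edge direction of `Q(w)` (`Q` homogeneous) — on an arc off the crossing
directions this says `EN(P(w)) ⊆ X`, `nv ≤ 9t²`. -/
theorem dependentCase3 (ν : Fin 2 → ℝ) (w : Fin 3 → Poly2) (p₀ p₁ : Fin 2 →₀ ℕ) (Q : Poly3) (k : ℕ)
    (hΩ : omega w = 0) (h0 : IsUniqueTop ν (w 0) p₀) (h1 : IsUniqueTop ν (w 1) p₁) (h01 : wt ν p₀ ≠ wt ν p₁)
    (hQ : Q.IsHomogeneous k) : ¬ IsEdgeDir ν (aeval w Q) := by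
  intro hedge
  have hL : ell k (w 0) (w 1) (aeval w Q) = 0 := by rw [← wronskianRule w Q k hQ, hΩ, zero_mul]
  obtain ⟨p, hp, q, hq, hpq, hpmax, hwq⟩ := hedge
  have onl : ∀ γ ∈ (aeval w Q).support, wt ν γ = wt ν p → lam k p₀ p₁ γ = 0 := by
    intro γ hγ hw
    have htop : ∀ r ∈ (aeval w Q).support, wt ν r ≤ wt ν γ := fun r hr => hw ▸ hpmax r hr
    have hc := coeff_ell_top ν _ (w 0) (w 1) k p₀ p₁ γ h0 h1 hγ htop
    rw [hL, coeff_zero] at hc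
    have h3 : ((lam k p₀ p₁ γ : ℤ) : ℂ) = 0 := by
      rcases mul_eq_zero.mp hc.symm with h | h
      · rcases mul_eq_zero.mp h with h | h
        · rcases mul_eq_zero.mp h with h | h
          · exact absurd h (MvPolynomial.mem_support_iff.mp hγ)
          · exact absurd h (MvPolynomial.mem_support_iff.mp h0.1)
        · exact absurd h (MvPolynomial.mem_support_iff.mp h1.1)
      · exact h
    exact_mod_cast h3
  exact hpq (onLine_unique ν k p₀ p₁ p q h01 hwq.symm (onl p hp rfl) (onl q hq hwq))

end Summit.ValiantsHypothesis.ValiantsHypothesis.Theorems.TwoProducts.RankTwoJacobian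

end
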